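import Literature.Topology.FourManifolds.HomotopyS4FoldMap
import Literature.Topology.FourManifolds.HomotopyS4CompactProofs
import Literature.Topology.FourManifolds.ClosedBallSmoothMaps
import HarnessLib

/-!
# Fold maps of homotopy 4-spheres: the local model, the reduction to a pole immersion, and
# Gromov's example `S⁴ → ℝ⁴`

Sibling proof file of `Literature/Topology/FourManifolds/HomotopyS4FoldMap.lean`, whose named
fact `Literature.Topology.FourManifolds.eliashberg_foldMap_homotopySphere_four` (Eliashberg's
equidimensional folding theorem, instance "every smooth homotopy 4-sphere folds into `ℝ⁴` along
the boundary of a coordinate ball", M. Gromov, *Partial Differential Relations* (1986), §2.1.3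
(D), Theorem p. 59, with the fold normal form of §1.3.1 (B), p. 27) is NOT discharged here: its
printed proof is the `h`-principle for folded maps (loc. cit. (A′)–(D): relative and
one-parametric immersion theory on the open pieces, Poenaru's pleating lemma, the folded-function
lemma and the circle/twist trick) together with the computation of the formal datum (triviality
of the folded tangent bundle of a homotopy 4-sphere: Euler number, Kervaire–Milnor, Dold–Whitney),
a theory absent from Mathlib and from the tree.  What IS proved here, sorry-free:

* §1 **The radial fold** `radialFold n : ℝⁿ⁺¹ → ℝⁿ⁺¹`, `w ↦ 2w / (1 + ‖w‖²)` — the linear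
  projection `Sⁿ⁺¹ ⊂ ℝⁿ⁺² → ℝⁿ⁺¹` of Gromov's Example (p. 59, "if `Σ` is an equator in the sphere
  `Sⁿ` …") read in a stereographic chart: it is `C^∞`, invariant under the inversion
  `w ↦ w / ‖w‖²` (the reflection in the equator), its differential is injective off the unit
  sphere, and it folds along the unit sphere.
* §2 **The fold normal form of §1.3.1 (B)** for `radialFold`: explicit charts `foldSourceChart p`,
  `foldTargetChart p` of the `C^∞` maximal atlas of `ℝⁿ⁺¹` (polar coordinates `polarChart p` of
  `ClosedBallProofs.lean` followed by a Möbius change of the radial coordinate) in which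
  `radialFold` reads `(u₀, u₁, …, uₙ) ↦ (u₀², u₁, …, uₙ)`, the unit sphere being `{u₀ = 0}`
  (`foldTargetChart_radialFold`).
* §3 **Reduction of the fact to a pole immersion** (`exists_foldMap_of_poleImmersion`): if a
  compact `C^∞` 4-manifold `M` carries a chart `χ` centred at `q` and a map `g : M → ℝ⁴` which is
  a `C^∞` immersion on `M ∖ {q}` and equals the inverted chart `χ / ‖χ‖²` near `q` ("an immersion
  of the punctured manifold with a standard pole at `q`"), then `f = F_r ∘ g`,
  `F_r (v) = r · radialFold (v / r)` with `r` large, is a `C^∞` map `M → ℝ⁴` folding exactly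
  along the coordinate sphere `‖χ‖ = 1/r` and immersive elsewhere — i.e. the conclusion of the
  named fact holds for `M`.  (For a homotopy 4-sphere the existence of such a pole immersion is
  equivalent to the instance of Eliashberg's theorem and is exactly the missing `h`-principle.)
* §4 **The fact over pole immersions** (`eliashberg_foldMap_homotopySphere_four_of_poleImmersion`):
  the named fact follows from the existence of a pole immersion on every homotopy 4-sphere
  (compactness of homotopy 4-spheres is the tree's
  `compactSpace_of_homotopyEquiv_sphere_four_holds`).

## References

* M. Gromov, *Partial Differential Relations*, Springer (1986): §1.3.1 (B) p. 27 (folds, normal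
  form), §2.1.3 (D) p. 59 (Equidimensional Folding Theorem, Example). [Gromov1986]
* Y. Eliashberg, *On singularities of folding type*, Math. USSR Izv. 4 (1970) 1119–1134.
  [Eliashberg1970]
* A. Cannas da Silva, *Fold-forms for four-folds*, J. Symplectic Geom. 8 (2010), §4.
  [Cannasdasilva2010]
-/

noncomputable section

open Set Function Metric Module OpenPartialHomeomorph
open scoped Manifold ContDiff Topology ContinuousMap

namespace Literature.Topology.FourManifolds

/-- Local notation: `𝔼 n` is the model Euclidean space `EuclideanSpace ℝ (Fin n)`. -/
local notation "𝔼 " n:arg => EuclideanSpace ℝ (Fin n)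

/-- Local notation: `𝕊 n` is the unit sphere in `EuclideanSpace ℝ (Fin (n + 1))`. -/
local notation "𝕊 " n:arg => (Metric.sphere (0 : EuclideanSpace ℝ (Fin (n + 1))) 1)

attribute [local instance] fact_finrank_euclideanSpace_succ

variable {n : ℕ}

/-! ### §1 The radial fold `w ↦ 2w / (1 + ‖w‖²)` -/

/-- **The radial fold** of `ℝⁿ⁺¹` along the unit sphere, `w ↦ 2 w / (1 + ‖w‖²)`: the linear
projection `Sⁿ⁺¹ → ℝⁿ⁺¹` (dropping the last coordinate) of Gromov's Example, PDR §2.1.3 (D)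
p. 59, written in the stereographic chart of `Sⁿ⁺¹` whose unit sphere is the equator.  It maps
`ℝⁿ⁺¹` onto the closed unit ball, both the unit ball and its exterior diffeomorphically onto the
open unit ball, and folds along the unit sphere. [cite: Gromov1986, §2.1.3 (D) Example p. 59] -/
def radialFold (n : ℕ) (w : 𝔼 (n + 1)) : 𝔼 (n + 1) := (2 / (1 + ‖w‖ ^ 2)) • w

/-- `1 + ‖w‖² > 0`. [folklore] -/
theorem one_add_norm_sq_pos_radialFold (w : 𝔼 (n + 1)) : 0 < 1 + ‖w‖ ^ 2 := by positivity

/-- Unfolding of `radialFold`. [cite: Gromov1986, §2.1.3 (D) Example p. 59] -/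
theorem radialFold_apply (w : 𝔼 (n + 1)) : radialFold n w = (2 / (1 + ‖w‖ ^ 2)) • w := rfl

/-- `radialFold 0 = 0`. [cite: Gromov1986, §2.1.3 (D) Example p. 59] -/
@[simp] theorem radialFold_zero : radialFold n 0 = 0 := by simp [radialFold]

/-- The radial fold is `C^∞`. [cite: Gromov1986, §2.1.3 (D) Example p. 59] -/
theorem contDiff_radialFold : ContDiff ℝ ∞ (radialFold n) := by
  have h : ContDiff ℝ ∞ fun w : 𝔼 (n + 1) => ‖w‖ ^ 2 := contDiff_norm_sq ℝ
  have h2 : ContDiff ℝ ∞ fun w : 𝔼 (n + 1) => 2 / (1 + ‖w‖ ^ 2) :=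
    contDiff_const.div (contDiff_const.add h) fun w => (one_add_norm_sq_pos_radialFold w).ne'
  exact h2.smul contDiff_id

/-- `‖2w / (1 + ‖w‖²)‖ = 2‖w‖ / (1 + ‖w‖²)`. [cite: Gromov1986, §2.1.3 (D) Example p. 59] -/
theorem norm_radialFold (w : 𝔼 (n + 1)) : ‖radialFold n w‖ = 2 * ‖w‖ / (1 + ‖w‖ ^ 2) := by
  rw [radialFold_apply, norm_smul, Real.norm_of_nonneg (by positivity)]
  ring

/-- The radial fold vanishes only at the origin. [cite: Gromov1986, §2.1.3 (D) Example p. 59] -/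
theorem radialFold_ne_zero {w : 𝔼 (n + 1)} (hw : w ≠ 0) : radialFold n w ≠ 0 := by
  rw [radialFold_apply]
  exact smul_ne_zero (div_pos two_pos (one_add_norm_sq_pos_radialFold w)).ne' hw

/-- The radial fold preserves directions: `radialFold w` is the positive multiple
`2‖w‖/(1+‖w‖²)` of the unit vector `w / ‖w‖`. [cite: Gromov1986, §2.1.3 (D) Example p. 59] -/
theorem radialFold_eq_smul_radialProjection (p : 𝕊 n) (w : 𝔼 (n + 1)) :
    radialFold n w = (2 * ‖w‖ / (1 + ‖w‖ ^ 2)) • (radialProjection p w : 𝔼 (n + 1)) := by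
  calc radialFold n w
      = (2 / (1 + ‖w‖ ^ 2)) • (‖w‖ • (radialProjection p w : 𝔼 (n + 1))) := by
        rw [norm_smul_coe_radialProjection, radialFold_apply]
    _ = (2 * ‖w‖ / (1 + ‖w‖ ^ 2)) • (radialProjection p w : 𝔼 (n + 1)) := by
        rw [smul_smul]
        congr 1
        ring

/-- The radial fold does not change the radial projection to the unit sphere.
[cite: Gromov1986, §2.1.3 (D) Example p. 59] -/
theorem radialProjection_radialFold (p : 𝕊 n) {w : 𝔼 (n + 1)} (hw : w ≠ 0) :
    radialProjection p (radialFold n w) = radialProjection p w := by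
  rw [radialFold_eq_smul_radialProjection p w]
  exact radialProjection_smul p
    (div_pos (mul_pos two_pos (norm_pos_iff.2 hw)) (one_add_norm_sq_pos_radialFold w)) _

/-- **Invariance under the inversion in the unit sphere**: `radialFold (w / ‖w‖²) = radialFold w`
(the two sheets of the fold are exchanged by the inversion, i.e. by the reflection of `Sⁿ⁺¹` in
its equator). [cite: Gromov1986, §2.1.3 (D) Example p. 59] -/
theorem radialFold_inversion {w : 𝔼 (n + 1)} (hw : w ≠ 0) :
    radialFold n ((‖w‖ ^ 2)⁻¹ • w) = radialFold n w := by
  have hn : ‖w‖ ≠ 0 := norm_ne_zero_iff.2 hw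
  have hn2 : ‖w‖ ^ 2 ≠ 0 := pow_ne_zero 2 hn
  rw [radialFold_apply, radialFold_apply, norm_smul, norm_inv, norm_pow, norm_norm, smul_smul]
  congr 1
  field_simp
  ring

/-- The radial fold of a rescaled vector, inverted: `radialFold (r⁻¹ • (χ / ‖χ‖²)) =
radialFold (r • χ)` — the identity behind `F_r ∘ (χ / ‖χ‖²) = r · radialFold (r χ)` in §3.
[cite: Gromov1986, §2.1.3 (D) Example p. 59] -/
theorem radialFold_inv_smul_inversion {r : ℝ} (hr : 0 < r) {u : 𝔼 (n + 1)} (hu : u ≠ 0) :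
    radialFold n (r⁻¹ • (‖u‖ ^ 2)⁻¹ • u) = radialFold n (r • u) := by
  have hru : r • u ≠ 0 := smul_ne_zero hr.ne' hu
  rw [← radialFold_inversion hru, norm_smul, Real.norm_of_nonneg hr.le, smul_smul, smul_smul]
  congr 1
  have hn : ‖u‖ ≠ 0 := norm_ne_zero_iff.2 hu
  field_simp

/-- The derivative of the radial fold at `w`:
`h ↦ 2/(1+‖w‖²) · h - 4⟪w,h⟫/(1+‖w‖²)² · w`. [cite: Gromov1986, §2.1.3 (D) Example p. 59] -/
def radialFoldDeriv (n : ℕ) (w : 𝔼 (n + 1)) : 𝔼 (n + 1) →L[ℝ] 𝔼 (n + 1) :=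
  (2 / (1 + ‖w‖ ^ 2)) • ContinuousLinearMap.id ℝ (𝔼 (n + 1)) -
    (4 / (1 + ‖w‖ ^ 2) ^ 2) • (innerSL ℝ w).smulRight w

/-- Unfolding of `radialFoldDeriv`. [cite: Gromov1986, §2.1.3 (D) Example p. 59] -/
theorem radialFoldDeriv_apply (w h : 𝔼 (n + 1)) :
    radialFoldDeriv n w h =
      (2 / (1 + ‖w‖ ^ 2)) • h - (4 / (1 + ‖w‖ ^ 2) ^ 2 * inner ℝ w h) • w := by
  simp [radialFoldDeriv, mul_smul]

/-- The radial fold has derivative `radialFoldDeriv n w` at `w`.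
[cite: Gromov1986, §2.1.3 (D) Example p. 59] -/
theorem hasFDerivAt_radialFold (w : 𝔼 (n + 1)) :
    HasFDerivAt (radialFold n) (radialFoldDeriv n w) w := by
  have hq : (1 + ‖w‖ ^ 2) ≠ 0 := (one_add_norm_sq_pos_radialFold w).ne'
  have h1 : HasFDerivAt (fun y : 𝔼 (n + 1) => 1 + ‖y‖ ^ 2) (2 • innerSL ℝ w) w :=
    ((hasStrictFDerivAt_norm_sq w).hasFDerivAt).const_add 1
  have h2 : HasFDerivAt (fun y : 𝔼 (n + 1) => (1 + ‖y‖ ^ 2)⁻¹)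
      ((ContinuousLinearMap.toSpanSingleton ℝ (-((1 + ‖w‖ ^ 2) ^ 2)⁻¹)).comp
        (2 • innerSL ℝ w)) w :=
    (hasFDerivAt_inv hq).comp w h1
  have h3 := (h2.const_mul (2 : ℝ)).smul (hasFDerivAt_id (𝕜 := ℝ) w)
  have h4 : HasFDerivAt (radialFold n) _ w :=
    h3.congr_of_eventuallyEq (Filter.Eventually.of_forall fun y => by
      simp [radialFold, div_eq_mul_inv])
  refine h4.congr_fderiv (ContinuousLinearMap.ext fun h => ?_)
  rw [radialFoldDeriv_apply]
  simp
  module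

/-- **The radial fold is an immersion off the unit sphere**: its differential at `w` is
injective whenever `‖w‖ ≠ 1`. (Indeed `radialFoldDeriv w h = a h - b ⟪w, h⟫ w` with
`a = 2/(1+‖w‖²)`, `b = 4/(1+‖w‖²)²`; pairing with `w` gives `⟪w,h⟫ (a - b‖w‖²) = 0` and
`a - b‖w‖² = 2(1-‖w‖²)/(1+‖w‖²)² ≠ 0`, whence `⟪w,h⟫ = 0` and `h = 0`.)
[cite: Gromov1986, §2.1.3 (D) Example p. 59] -/
theorem injective_radialFoldDeriv {w : 𝔼 (n + 1)} (hw : ‖w‖ ≠ 1) :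
    Injective (radialFoldDeriv n w) := by
  refine (injective_iff_map_eq_zero (radialFoldDeriv n w)).2 fun h hh => ?_
  have hq : 0 < 1 + ‖w‖ ^ 2 := one_add_norm_sq_pos_radialFold w
  rw [radialFoldDeriv_apply] at hh
  -- pair with `w`
  have hinner : inner ℝ w h * (2 * (1 - ‖w‖ ^ 2) / (1 + ‖w‖ ^ 2) ^ 2) = 0 := by
    have := congrArg (fun v => inner ℝ w v) hh
    simp only [inner_sub_right, inner_smul_right, inner_zero_right,
      real_inner_self_eq_norm_sq] at this
    have h' : inner ℝ w h * (2 * (1 - ‖w‖ ^ 2) / (1 + ‖w‖ ^ 2) ^ 2) =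
        2 / (1 + ‖w‖ ^ 2) * inner ℝ w h -
          4 / (1 + ‖w‖ ^ 2) ^ 2 * inner ℝ w h * ‖w‖ ^ 2 := by
      field_simp
      ring
    rw [h', this]
  have hne : 2 * (1 - ‖w‖ ^ 2) / (1 + ‖w‖ ^ 2) ^ 2 ≠ 0 := by
    refine div_ne_zero (mul_ne_zero two_ne_zero (sub_ne_zero.2 ?_)) (by positivity)
    intro h1
    apply hw
    have : ‖w‖ ^ 2 = 1 ^ 2 := by rw [← h1, one_pow]
    exact (pow_left_inj₀ (norm_nonneg w) zero_le_one two_ne_zero).1 this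
  have h0 : inner ℝ w h = 0 := (mul_eq_zero.1 hinner).resolve_right hne
  rw [h0, mul_zero, zero_smul, sub_zero] at hh
  exact (smul_eq_zero.1 hh).resolve_left (div_pos two_pos hq).ne'

/-- Off the unit sphere the Fréchet derivative of the radial fold is injective.
[cite: Gromov1986, §2.1.3 (D) Example p. 59] -/
theorem injective_fderiv_radialFold {w : 𝔼 (n + 1)} (hw : ‖w‖ ≠ 1) :
    Injective (fderiv ℝ (radialFold n) w) := by
  rw [(hasFDerivAt_radialFold w).fderiv]
  exact injective_radialFoldDeriv hw

/-! ### §2 The fold normal form of the radial fold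

Charts: `polarChart p` (`ClosedBallProofs.lean`: `w ↦ (1 - ‖w‖, σ (w/‖w‖))`,
`σ = stereographic' n (-p)`, source `{w ≠ 0, w/‖w‖ ≠ -p}`, target `{z | z 0 < 1}`) followed by
a Möbius transformation of the `0`-th coordinate: `z₀ ↦ -z₀/(2 - z₀)` on the source side (so that
the `0`-th coordinate becomes `(‖w‖ - 1)/(‖w‖ + 1)`, odd under `‖w‖ ↦ 1/‖w‖`) and
`z₀ ↦ z₀/(2 - z₀)` on the target side (`0`-th coordinate `(1 - ‖v‖)/(1 + ‖v‖)`); then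
`(1 - ‖radialFold w‖)/(1 + ‖radialFold w‖) = ((‖w‖ - 1)/(‖w‖ + 1))²`. -/

/-- Replace the `0`-th coordinate of `z ∈ ℝⁿ⁺¹` by `t`. [folklore] -/
def setZero (z : 𝔼 (n + 1)) (t : ℝ) : 𝔼 (n + 1) := z + (t - z 0) • EuclideanSpace.single 0 1

/-- The new `0`-th coordinate. [folklore] -/
@[simp] theorem setZero_apply_zero (z : 𝔼 (n + 1)) (t : ℝ) : setZero z t 0 = t := by
  simp [setZero]

/-- The other coordinates are untouched. [folklore] -/
theorem setZero_apply_of_ne_zero (z : 𝔼 (n + 1)) (t : ℝ) {i : Fin (n + 1)} (hi : i ≠ 0) :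
    setZero z t i = z i := by
  simp [setZero, hi]

/-- The other coordinates are untouched (successor form). [folklore] -/
@[simp] theorem setZero_apply_succ (z : 𝔼 (n + 1)) (t : ℝ) (i : Fin n) :
    setZero z t i.succ = z i.succ :=
  setZero_apply_of_ne_zero z t (Fin.succ_ne_zero i)

/-- Setting the `0`-th coordinate twice. [folklore] -/
@[simp] theorem setZero_setZero (z : 𝔼 (n + 1)) (t t' : ℝ) :
    setZero (setZero z t) t' = setZero z t' := by
  ext i
  refine Fin.cases ?_ (fun j => ?_) i <;> simp

/-- Setting the `0`-th coordinate to its own value. [folklore] -/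
@[simp] theorem setZero_self (z : 𝔼 (n + 1)) : setZero z (z 0) = z := by
  simp [setZero]

/-- Smoothness of `z ↦ setZero z (φ z)` on a set where `φ` is smooth. [folklore] -/
theorem ContDiffOn.setZero {φ : 𝔼 (n + 1) → ℝ} {s : Set (𝔼 (n + 1))} (hφ : ContDiffOn ℝ ∞ φ s) :
    ContDiffOn ℝ ∞ (fun z => setZero z (φ z)) s :=
  contDiffOn_id.add ((hφ.sub (contDiff_piLp_apply 2).contDiffOn).smul contDiffOn_const)

/-- The `0`-th coordinate is continuous. [folklore] -/
theorem continuous_apply_zero : Continuous fun z : 𝔼 (n + 1) => z 0 := by fun_prop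

/-- **The Möbius chart of the radial coordinate, source side**: `z₀ ↦ -z₀ / (2 - z₀)` on
`{z₀ < 1}`, onto `{-1 < z₀ < 1}`, inverse `t₀ ↦ 2 t₀ / (t₀ - 1)`; the other coordinates are
untouched. [folklore] -/
def mobiusChartA : OpenPartialHomeomorph (𝔼 (n + 1)) (𝔼 (n + 1)) where
  toFun z := setZero z (-(z 0) / (2 - z 0))
  invFun t := setZero t (2 * t 0 / (t 0 - 1))
  source := {z | z 0 < 1}
  target := {t | -1 < t 0 ∧ t 0 < 1}
  map_source' z hz := by
    simp only [mem_setOf_eq, setZero_apply_zero] at hz ⊢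
    have hd : 0 < 2 - z 0 := by linarith
    constructor
    · rw [lt_div_iff₀ hd]; linarith
    · rw [div_lt_iff₀ hd]; linarith
  map_target' t ht := by
    simp only [mem_setOf_eq, setZero_apply_zero] at ht ⊢
    have hd : t 0 - 1 < 0 := by linarith
    rw [div_lt_iff_of_neg hd]; linarith
  left_inv' z hz := by
    simp only [mem_setOf_eq] at hz
    have hd : 2 - z 0 ≠ 0 := by linarith
    simp only [setZero_setZero, setZero_apply_zero]
    have : 2 * (-z 0 / (2 - z 0)) / (-z 0 / (2 - z 0) - 1) = z 0 := by
      have h1 : -z 0 / (2 - z 0) - 1 = -2 / (2 - z 0) := by field_simp; ring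
      rw [h1]
      field_simp
    rw [this, setZero_self]
  right_inv' t ht := by
    simp only [mem_setOf_eq] at ht
    have hd : t 0 - 1 ≠ 0 := by linarith
    simp only [setZero_setZero, setZero_apply_zero]
    have : -(2 * t 0 / (t 0 - 1)) / (2 - 2 * t 0 / (t 0 - 1)) = t 0 := by
      have h1 : 2 - 2 * t 0 / (t 0 - 1) = -2 / (t 0 - 1) := by field_simp; ring
      rw [h1]
      field_simp
    rw [this, setZero_self]
  open_source := isOpen_lt continuous_apply_zero continuous_const
  open_target := (isOpen_lt continuous_const continuous_apply_zero).inter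
    (isOpen_lt continuous_apply_zero continuous_const)
  continuousOn_toFun := by
    refine (ContDiffOn.setZero (ContDiffOn.div ?_ ?_ fun z hz => ?_)).continuousOn
    · exact (contDiff_piLp_apply 2).contDiffOn.neg
    · exact contDiffOn_const.sub (contDiff_piLp_apply 2).contDiffOn
    · simp only [mem_setOf_eq] at hz; linarith
  continuousOn_invFun := by
    refine (ContDiffOn.setZero (ContDiffOn.div ?_ ?_ fun z hz => ?_)).continuousOn
    · exact contDiffOn_const.mul (contDiff_piLp_apply 2).contDiffOn
    · exact (contDiff_piLp_apply 2).contDiffOn.sub contDiffOn_const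
    · simp only [mem_setOf_eq] at hz; linarith

/-- **The Möbius chart of the radial coordinate, target side**: `z₀ ↦ z₀ / (2 - z₀)` on
`{z₀ < 1}`, onto `{-1 < z₀ < 1}`, inverse `t₀ ↦ 2 t₀ / (1 + t₀)`. [folklore] -/
def mobiusChartB : OpenPartialHomeomorph (𝔼 (n + 1)) (𝔼 (n + 1)) where
  toFun z := setZero z (z 0 / (2 - z 0))
  invFun t := setZero t (2 * t 0 / (1 + t 0))
  source := {z | z 0 < 1}
  target := {t | -1 < t 0 ∧ t 0 < 1}
  map_source' z hz := by
    simp only [mem_setOf_eq, setZero_apply_zero] at hz ⊢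
    have hd : 0 < 2 - z 0 := by linarith
    constructor
    · rw [lt_div_iff₀ hd]; linarith
    · rw [div_lt_iff₀ hd]; linarith
  map_target' t ht := by
    simp only [mem_setOf_eq, setZero_apply_zero] at ht ⊢
    have hd : 0 < 1 + t 0 := by linarith
    rw [div_lt_iff₀ hd]; linarith
  left_inv' z hz := by
    simp only [mem_setOf_eq] at hz
    have hd : 2 - z 0 ≠ 0 := by linarith
    simp only [setZero_setZero, setZero_apply_zero]
    have : 2 * (z 0 / (2 - z 0)) / (1 + z 0 / (2 - z 0)) = z 0 := by
      have h1 : 1 + z 0 / (2 - z 0) = 2 / (2 - z 0) := by field_simp; ring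
      rw [h1]
      field_simp
    rw [this, setZero_self]
  right_inv' t ht := by
    simp only [mem_setOf_eq] at ht
    have hd : 1 + t 0 ≠ 0 := by linarith
    simp only [setZero_setZero, setZero_apply_zero]
    have : 2 * t 0 / (1 + t 0) / (2 - 2 * t 0 / (1 + t 0)) = t 0 := by
      have h1 : 2 - 2 * t 0 / (1 + t 0) = 2 / (1 + t 0) := by field_simp; ring
      rw [h1]
      field_simp
    rw [this, setZero_self]
  open_source := isOpen_lt continuous_apply_zero continuous_const
  open_target := (isOpen_lt continuous_const continuous_apply_zero).inter
    (isOpen_lt continuous_apply_zero continuous_const)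
  continuousOn_toFun := by
    refine (ContDiffOn.setZero (ContDiffOn.div ?_ ?_ fun z hz => ?_)).continuousOn
    · exact (contDiff_piLp_apply 2).contDiffOn
    · exact contDiffOn_const.sub (contDiff_piLp_apply 2).contDiffOn
    · simp only [mem_setOf_eq] at hz; linarith
  continuousOn_invFun := by
    refine (ContDiffOn.setZero (ContDiffOn.div ?_ ?_ fun z hz => ?_)).continuousOn
    · exact contDiffOn_const.mul (contDiff_piLp_apply 2).contDiffOn
    · exact contDiffOn_const.add (contDiff_piLp_apply 2).contDiffOn
    · simp only [mem_setOf_eq] at hz; linarith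

/-- The source-side Möbius chart in coordinates (definitional). [folklore] -/
theorem mobiusChartA_apply (z : 𝔼 (n + 1)) : mobiusChartA z = setZero z (-(z 0) / (2 - z 0)) :=
  rfl

/-- The target-side Möbius chart in coordinates (definitional). [folklore] -/
theorem mobiusChartB_apply (z : 𝔼 (n + 1)) : mobiusChartB z = setZero z (z 0 / (2 - z 0)) := rfl

/-- Source of the source-side Möbius chart (definitional). [folklore] -/
@[simp] theorem mobiusChartA_source : (mobiusChartA : OpenPartialHomeomorph (𝔼 (n + 1)) _).source =
    {z | z 0 < 1} := rfl

/-- Source of the target-side Möbius chart (definitional). [folklore] -/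
@[simp] theorem mobiusChartB_source : (mobiusChartB : OpenPartialHomeomorph (𝔼 (n + 1)) _).source =
    {z | z 0 < 1} := rfl

/-- The source-side Möbius chart is `C^∞` on its source. [folklore] -/
theorem contDiffOn_mobiusChartA :
    ContDiffOn ℝ ∞ (mobiusChartA : OpenPartialHomeomorph (𝔼 (n + 1)) _) mobiusChartA.source := by
  refine ContDiffOn.setZero (ContDiffOn.div ?_ ?_ fun z hz => ?_)
  · exact (contDiff_piLp_apply 2).contDiffOn.neg
  · exact contDiffOn_const.sub (contDiff_piLp_apply 2).contDiffOn
  · simp only [mobiusChartA_source, mem_setOf_eq] at hz; linarith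

/-- The inverse of the source-side Möbius chart is `C^∞` on its target. [folklore] -/
theorem contDiffOn_mobiusChartA_symm :
    ContDiffOn ℝ ∞ (mobiusChartA : OpenPartialHomeomorph (𝔼 (n + 1)) _).symm
      mobiusChartA.target := by
  refine ContDiffOn.setZero (ContDiffOn.div ?_ ?_ fun z hz => ?_)
  · exact contDiffOn_const.mul (contDiff_piLp_apply 2).contDiffOn
  · exact (contDiff_piLp_apply 2).contDiffOn.sub contDiffOn_const
  · have hz' : -1 < z 0 ∧ z 0 < 1 := hz
    linarith [hz'.2]

/-- The target-side Möbius chart is `C^∞` on its source. [folklore] -/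
theorem contDiffOn_mobiusChartB :
    ContDiffOn ℝ ∞ (mobiusChartB : OpenPartialHomeomorph (𝔼 (n + 1)) _) mobiusChartB.source := by
  refine ContDiffOn.setZero (ContDiffOn.div ?_ ?_ fun z hz => ?_)
  · exact (contDiff_piLp_apply 2).contDiffOn
  · exact contDiffOn_const.sub (contDiff_piLp_apply 2).contDiffOn
  · simp only [mobiusChartB_source, mem_setOf_eq] at hz; linarith

/-- The inverse of the target-side Möbius chart is `C^∞` on its target. [folklore] -/
theorem contDiffOn_mobiusChartB_symm :
    ContDiffOn ℝ ∞ (mobiusChartB : OpenPartialHomeomorph (𝔼 (n + 1)) _).symm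
      mobiusChartB.target := by
  refine ContDiffOn.setZero (ContDiffOn.div ?_ ?_ fun z hz => ?_)
  · exact contDiffOn_const.mul (contDiff_piLp_apply 2).contDiffOn
  · exact contDiffOn_const.add (contDiff_piLp_apply 2).contDiffOn
  · have hz' : -1 < z 0 ∧ z 0 < 1 := hz
    linarith [hz'.1]

/-- **Source chart of the fold normal form** at points of direction near `p`:
`w ↦ ((‖w‖ - 1)/(‖w‖ + 1), σ (w / ‖w‖))`, `σ = stereographic' n (-p)`.
[cite: Gromov1986, §1.3.1 (B) p. 27] -/
def foldSourceChart (p : 𝕊 n) : OpenPartialHomeomorph (𝔼 (n + 1)) (𝔼 (n + 1)) :=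
  (polarChart p).trans mobiusChartA

/-- **Target chart of the fold normal form** at points of direction near `p`:
`v ↦ ((1 - ‖v‖)/(1 + ‖v‖), σ (v / ‖v‖))`, `σ = stereographic' n (-p)`.
[cite: Gromov1986, §1.3.1 (B) p. 27] -/
def foldTargetChart (p : 𝕊 n) : OpenPartialHomeomorph (𝔼 (n + 1)) (𝔼 (n + 1)) :=
  (polarChart p).trans mobiusChartB

/-- The radial coordinate of the polar chart is `1 - ‖w‖`. [folklore] -/
theorem polarChart_apply_zero (p : 𝕊 n) (w : 𝔼 (n + 1)) : polarChart p w 0 = 1 - ‖w‖ := by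
  simp [polarChart_apply]

/-- The angular coordinates of the polar chart are the stereographic coordinates of `w/‖w‖`. [folklore] -/
theorem polarChart_apply_succ (p : 𝕊 n) (w : 𝔼 (n + 1)) (i : Fin n) :
    polarChart p w i.succ = stereographic' n (-p) (radialProjection p w) i := by
  simp [polarChart_apply]

/-- The source chart of the normal form has the source of the polar chart. [folklore] -/
@[simp] theorem foldSourceChart_source (p : 𝕊 n) :
    (foldSourceChart p).source = (polarChart p).source := by
  rw [foldSourceChart, trans_source, inter_eq_left]
  exact fun w hw => (polarChart p).map_source hw

/-- The target chart of the normal form has the source of the polar chart. [folklore] -/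
@[simp] theorem foldTargetChart_source (p : 𝕊 n) :
    (foldTargetChart p).source = (polarChart p).source := by
  rw [foldTargetChart, trans_source, inter_eq_left]
  exact fun w hw => (polarChart p).map_source hw

/-- The `0`-th source coordinate is `(‖w‖ - 1)/(‖w‖ + 1)`. [cite: Gromov1986, §1.3.1 (B) p. 27] -/
theorem foldSourceChart_apply_zero (p : 𝕊 n) (w : 𝔼 (n + 1)) :
    foldSourceChart p w 0 = (‖w‖ - 1) / (‖w‖ + 1) := by
  rw [foldSourceChart, coe_trans, comp_apply, mobiusChartA_apply, setZero_apply_zero,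
    polarChart_apply_zero]
  have : (2 : ℝ) - (1 - ‖w‖) = ‖w‖ + 1 := by ring
  rw [this, neg_sub]

/-- The `0`-th target coordinate is `(1 - ‖v‖)/(1 + ‖v‖)`. [cite: Gromov1986, §1.3.1 (B) p. 27] -/
theorem foldTargetChart_apply_zero (p : 𝕊 n) (v : 𝔼 (n + 1)) :
    foldTargetChart p v 0 = (1 - ‖v‖) / (1 + ‖v‖) := by
  rw [foldTargetChart, coe_trans, comp_apply, mobiusChartB_apply, setZero_apply_zero,
    polarChart_apply_zero]
  have : (2 : ℝ) - (1 - ‖v‖) = 1 + ‖v‖ := by ring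
  rw [this]

/-- The other source coordinates are the stereographic coordinates of the direction. [folklore] -/
theorem foldSourceChart_apply_succ (p : 𝕊 n) (w : 𝔼 (n + 1)) (i : Fin n) :
    foldSourceChart p w i.succ = stereographic' n (-p) (radialProjection p w) i := by
  rw [foldSourceChart, coe_trans, comp_apply, mobiusChartA_apply, setZero_apply_succ,
    polarChart_apply_succ]

/-- The other target coordinates are the stereographic coordinates of the direction. [folklore] -/
theorem foldTargetChart_apply_succ (p : 𝕊 n) (v : 𝔼 (n + 1)) (i : Fin n) :
    foldTargetChart p v i.succ = stereographic' n (-p) (radialProjection p v) i := by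
  rw [foldTargetChart, coe_trans, comp_apply, mobiusChartB_apply, setZero_apply_succ,
    polarChart_apply_succ]

/-- The `0`-th source coordinate vanishes exactly on the unit sphere.
[cite: Gromov1986, §1.3.1 (B) p. 27] -/
theorem foldSourceChart_apply_zero_eq_zero_iff (p : 𝕊 n) (w : 𝔼 (n + 1)) :
    foldSourceChart p w 0 = 0 ↔ ‖w‖ = 1 := by
  rw [foldSourceChart_apply_zero, div_eq_zero_iff, sub_eq_zero, or_iff_left]
  positivity

/-- The radial fold preserves the common source of the charts `{w ≠ 0, w/‖w‖ ≠ -p}`.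
[cite: Gromov1986, §2.1.3 (D) Example p. 59] -/
theorem radialFold_mem_polarChart_source {p : 𝕊 n} {w : 𝔼 (n + 1)}
    (hw : w ∈ (polarChart p).source) : radialFold n w ∈ (polarChart p).source := by
  rw [polarChart_source, mem_setOf_eq] at hw ⊢
  refine ⟨radialFold_ne_zero hw.1, ?_⟩
  rw [← coe_radialProjection_of_ne_zero p (radialFold_ne_zero hw.1),
    radialProjection_radialFold p hw.1, coe_radialProjection_of_ne_zero p hw.1]
  exact hw.2

/-- **Fold normal form of the radial fold** (Gromov, PDR §1.3.1 (B), p. 27: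
"`f : (u₁, u₂, …, uₙ) ↦ (u₁², u₂, …, uₙ)` for `V₀` given by `u₁ = 0`"): in the charts
`foldSourceChart p` / `foldTargetChart p` the radial fold reads `u ↦ u + (u₀² - u₀) e₀`, i.e.
`(u₀, u') ↦ (u₀², u')`, for every `w ≠ 0` with `w/‖w‖ ≠ -p`.
[cite: Gromov1986, §1.3.1 (B) p. 27 and §2.1.3 (D) Example p. 59] -/
theorem foldTargetChart_radialFold {p : 𝕊 n} {w : 𝔼 (n + 1)} (hw : w ∈ (polarChart p).source) :
    foldTargetChart p (radialFold n w) =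
      foldSourceChart p w + ((foldSourceChart p w 0) ^ 2 - foldSourceChart p w 0) •
        EuclideanSpace.single 0 1 := by
  have hw0 : w ≠ 0 := hw.1
  ext i
  refine Fin.cases ?_ (fun j => ?_) i
  · simp only [PiLp.add_apply, PiLp.smul_apply, PiLp.single_apply, if_true,
      smul_eq_mul, mul_one, add_sub_cancel]
    rw [foldTargetChart_apply_zero, foldSourceChart_apply_zero, norm_radialFold]
    have h1 : (0 : ℝ) < 1 + ‖w‖ ^ 2 := one_add_norm_sq_pos_radialFold w
    have h2 : (0 : ℝ) < ‖w‖ + 1 := by positivity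
    have h3 : (0 : ℝ) < 1 + 2 * ‖w‖ / (1 + ‖w‖ ^ 2) := by positivity
    field_simp
    ring
  · simp only [PiLp.add_apply, PiLp.smul_apply, PiLp.single_apply,
      Fin.succ_ne_zero, if_false, smul_zero, add_zero]
    rw [foldTargetChart_apply_succ, foldSourceChart_apply_succ, radialProjection_radialFold p hw0]

/-- An open partial homeomorphism of `ℝⁿ⁺¹` which is `C^∞` on its source with `C^∞` inverse on
its target is a chart of the `C^∞` maximal atlas of `ℝⁿ⁺¹`. [folklore] -/
theorem mem_maximalAtlas_euclidean_of_contDiffOn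
    {e : OpenPartialHomeomorph (𝔼 (n + 1)) (𝔼 (n + 1))}
    (he : ContDiffOn ℝ ∞ e e.source) (he' : ContDiffOn ℝ ∞ e.symm e.target) :
    e ∈ IsManifold.maximalAtlas (𝓡 (n + 1)) ∞ (𝔼 (n + 1)) := by
  rw [IsManifold.mem_maximalAtlas_iff_contMDiffOn]
  exact ⟨contMDiffOn_iff_contDiffOn.2 he, contMDiffOn_iff_contDiffOn.2 he'⟩

/-- A polar chart followed by a `C^∞` chart of `ℝⁿ⁺¹` is `C^∞` on its source. [folklore] -/
theorem contDiffOn_polarChart_trans (p : 𝕊 n) {T : OpenPartialHomeomorph (𝔼 (n + 1)) (𝔼 (n + 1))}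
    (hT : ContDiffOn ℝ ∞ T T.source) :
    ContDiffOn ℝ ∞ ((polarChart p).trans T) ((polarChart p).trans T).source := by
  rw [coe_trans, trans_source]
  exact hT.comp ((contDiffOn_polarChart p).mono inter_subset_left) fun w hw => hw.2

/-- The inverse of a polar chart followed by a chart with `C^∞` inverse is `C^∞` on its target. [folklore] -/
theorem contDiffOn_polarChart_trans_symm (p : 𝕊 n)
    {T : OpenPartialHomeomorph (𝔼 (n + 1)) (𝔼 (n + 1))} (hT : ContDiffOn ℝ ∞ T.symm T.target) :
    ContDiffOn ℝ ∞ ((polarChart p).trans T).symm ((polarChart p).trans T).target := by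
  rw [coe_trans_symm, trans_target]
  exact (contDiff_polarChart_symm p).comp_contDiffOn (hT.mono inter_subset_left)

/-- The source chart of the normal form is `C^∞` on its source. [folklore] -/
theorem contDiffOn_foldSourceChart (p : 𝕊 n) :
    ContDiffOn ℝ ∞ (foldSourceChart p) (foldSourceChart p).source :=
  contDiffOn_polarChart_trans p contDiffOn_mobiusChartA

/-- The inverse of the source chart of the normal form is `C^∞` on its target. [folklore] -/
theorem contDiffOn_foldSourceChart_symm (p : 𝕊 n) :
    ContDiffOn ℝ ∞ (foldSourceChart p).symm (foldSourceChart p).target :=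
  contDiffOn_polarChart_trans_symm p contDiffOn_mobiusChartA_symm

/-- The target chart of the normal form is `C^∞` on its source. [folklore] -/
theorem contDiffOn_foldTargetChart (p : 𝕊 n) :
    ContDiffOn ℝ ∞ (foldTargetChart p) (foldTargetChart p).source :=
  contDiffOn_polarChart_trans p contDiffOn_mobiusChartB

/-- The inverse of the target chart of the normal form is `C^∞` on its target. [folklore] -/
theorem contDiffOn_foldTargetChart_symm (p : 𝕊 n) :
    ContDiffOn ℝ ∞ (foldTargetChart p).symm (foldTargetChart p).target :=
  contDiffOn_polarChart_trans_symm p contDiffOn_mobiusChartB_symm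

/-- The source chart of the normal form is a chart of the `C^∞` maximal atlas of `ℝⁿ⁺¹`.
[cite: Gromov1986, §1.3.1 (B) p. 27] -/
theorem foldSourceChart_mem_maximalAtlas (p : 𝕊 n) :
    foldSourceChart p ∈ IsManifold.maximalAtlas (𝓡 (n + 1)) ∞ (𝔼 (n + 1)) :=
  mem_maximalAtlas_euclidean_of_contDiffOn (contDiffOn_foldSourceChart p)
    (contDiffOn_foldSourceChart_symm p)

/-- The target chart of the normal form is a chart of the `C^∞` maximal atlas of `ℝⁿ⁺¹`.
[cite: Gromov1986, §1.3.1 (B) p. 27] -/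
theorem foldTargetChart_mem_maximalAtlas (p : 𝕊 n) :
    foldTargetChart p ∈ IsManifold.maximalAtlas (𝓡 (n + 1)) ∞ (𝔼 (n + 1)) :=
  mem_maximalAtlas_euclidean_of_contDiffOn (contDiffOn_foldTargetChart p)
    (contDiffOn_foldTargetChart_symm p)


/-- **The scaled radial folds `v ↦ a · radialFold (b v)` are immersions off `‖b v‖ = 1`.**
[cite: Gromov1986, §2.1.3 (D) Example p. 59] -/
theorem injective_fderiv_smul_radialFold_smul {a b : ℝ} (ha : a ≠ 0) (hb : b ≠ 0)
    {u : 𝔼 (n + 1)} (hu : ‖b • u‖ ≠ 1) :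
    Injective (fderiv ℝ (fun v => a • radialFold n (b • v)) u) := by
  have h : HasFDerivAt (fun v => a • radialFold n (b • v))
      (a • (radialFoldDeriv n (b • u)).comp (b • ContinuousLinearMap.id ℝ (𝔼 (n + 1)))) u :=
    ((hasFDerivAt_radialFold (b • u)).comp u ((hasFDerivAt_id u).const_smul b)).const_smul a
  rw [h.fderiv]
  intro h₁ h₂ hh
  have hh' : a • radialFoldDeriv n (b • u) (b • h₁) = a • radialFoldDeriv n (b • u) (b • h₂) := by
    simpa using hh
  exact smul_right_injective _ hb
    (injective_radialFoldDeriv hu (smul_right_injective _ ha hh'))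

/-- The scaled radial folds are `C^∞`. [cite: Gromov1986, §2.1.3 (D) Example p. 59] -/
theorem contDiff_smul_radialFold_smul (a b : ℝ) :
    ContDiff ℝ ∞ (fun v : 𝔼 (n + 1) => a • radialFold n (b • v)) :=
  (contDiff_radialFold.comp (contDiff_id.const_smul b)).const_smul a

/-! ### §3 Reduction of the fold map to an immersion of the punctured manifold with a pole

Let `M` be a compact `C^∞` manifold modelled on `ℝⁿ⁺¹`, `χ` a chart of its maximal atlas centred
at `q` (`χ q = 0`) and `g : M → ℝⁿ⁺¹` a `C^∞` immersion of `M ∖ {q}` which on `χ.source ∖ {q}`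
is the inverted chart `χ / ‖χ‖²`.  For `r > 0` put `F_r (v) = r · radialFold (v / r)` (the
radial fold along the sphere of radius `r`) and `f = F_r ∘ g`, `f q = 0`.  On `χ.source`,
`f = r · radialFold (r χ)` (`radialFold_inv_smul_inversion`), a `C^∞` map folding along the
coordinate sphere `‖χ‖ = 1/r` and immersive elsewhere on `χ.source` (also at `q`); off
`χ.source`, `‖g‖ < r` for `r` large (compactness), where `F_r` is a local diffeomorphism.  The
coordinate sphere is `e(𝕊ⁿ)` for the smooth open embedding `e = χ⁻¹ ∘ (c · univUnitBall)`,
`c = √2 / r`, of `ℝⁿ⁺¹` onto the coordinate ball of radius `c`, and the fold normal form at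
`e m`, `m ∈ 𝕊ⁿ`, is read in the charts `foldSourceChart m ∘ (r · χ)` and
`foldTargetChart m ∘ (r⁻¹ · )` of §2. -/

section Reduction

variable {M : Type*} [TopologicalSpace M]

/-- A `C^∞` open partial homeomorphism of `ℝⁿ⁺¹` with `C^∞` inverse is differentiable in the
manifold sense (both ways). [folklore] -/
theorem mdifferentiable_of_contDiffOn {T : OpenPartialHomeomorph (𝔼 (n + 1)) (𝔼 (n + 1))}
    (h1 : ContDiffOn ℝ ∞ T T.source) (h2 : ContDiffOn ℝ ∞ T.symm T.target) :
    T.MDifferentiable (𝓡 (n + 1)) (𝓡 (n + 1)) :=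
  ⟨(contMDiffOn_iff_contDiffOn.2 h1).mdifferentiableOn (by simp),
    (contMDiffOn_iff_contDiffOn.2 h2).mdifferentiableOn (by simp)⟩

/-- A chart of the `C^∞` maximal atlas is differentiable in the manifold sense (both ways).
[folklore] -/
theorem mdifferentiable_of_mem_maximalAtlas_model [ChartedSpace (𝔼 (n + 1)) M]
    [IsManifold (𝓡 (n + 1)) ∞ M] {χ : OpenPartialHomeomorph M (𝔼 (n + 1))}
    (hχ : χ ∈ IsManifold.maximalAtlas (𝓡 (n + 1)) ∞ M) :
    χ.MDifferentiable (𝓡 (n + 1)) (𝓡 (n + 1)) :=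
  ⟨(contMDiffOn_of_mem_maximalAtlas hχ).mdifferentiableOn (by simp),
    (contMDiffOn_symm_of_mem_maximalAtlas hχ).mdifferentiableOn (by simp)⟩

/-- The homothety `u ↦ c • u` (`c ≠ 0`) of `ℝⁿ⁺¹` as a global chart. [folklore] -/
def scaleChart (c : ℝ) (hc : c ≠ 0) : OpenPartialHomeomorph (𝔼 (n + 1)) (𝔼 (n + 1)) :=
  (Homeomorph.smulOfNeZero c hc).toOpenPartialHomeomorph

/-- The homothety chart is `u ↦ c • u` (definitional). [folklore] -/
@[simp] theorem scaleChart_apply (c : ℝ) (hc : c ≠ 0) (u : 𝔼 (n + 1)) :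
    scaleChart c hc u = c • u := rfl

/-- The inverse of the homothety chart is `u ↦ c⁻¹ • u`. [folklore] -/
@[simp] theorem scaleChart_symm_apply (c : ℝ) (hc : c ≠ 0) (u : 𝔼 (n + 1)) :
    (scaleChart c hc).symm u = c⁻¹ • u :=
  congrFun (Homeomorph.smulOfNeZero_symm_apply hc) u

/-- The homothety chart is global (definitional). [folklore] -/
@[simp] theorem scaleChart_source (c : ℝ) (hc : c ≠ 0) :
    (scaleChart (n := n) c hc).source = univ := rfl

/-- The homothety chart is onto (definitional). [folklore] -/
@[simp] theorem scaleChart_target (c : ℝ) (hc : c ≠ 0) :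
    (scaleChart (n := n) c hc).target = univ := rfl

/-- A homothety followed by a `C^∞` chart is `C^∞` on its source. [folklore] -/
theorem contDiffOn_scaleChart_trans {c : ℝ} (hc : c ≠ 0)
    {T : OpenPartialHomeomorph (𝔼 (n + 1)) (𝔼 (n + 1))} (hT : ContDiffOn ℝ ∞ T T.source) :
    ContDiffOn ℝ ∞ ((scaleChart c hc).trans T) ((scaleChart c hc).trans T).source := by
  rw [coe_trans, trans_source]
  refine hT.comp ?_ fun w hw => hw.2
  exact (contDiff_id.const_smul c).contDiffOn

/-- The inverse of a homothety followed by a chart with `C^∞` inverse is `C^∞` on its target. [folklore] -/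
theorem contDiffOn_scaleChart_trans_symm {c : ℝ} (hc : c ≠ 0)
    {T : OpenPartialHomeomorph (𝔼 (n + 1)) (𝔼 (n + 1))} (hT : ContDiffOn ℝ ∞ T.symm T.target) :
    ContDiffOn ℝ ∞ ((scaleChart c hc).trans T).symm ((scaleChart c hc).trans T).target := by
  rw [coe_trans_symm, trans_target]
  have : ContDiff ℝ ∞ (scaleChart (n := n) c hc).symm := by
    have h : ((scaleChart (n := n) c hc).symm : 𝔼 (n + 1) → 𝔼 (n + 1)) = fun u => c⁻¹ • u :=
      funext (scaleChart_symm_apply c hc)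
    rw [h]
    exact contDiff_id.const_smul _
  exact this.comp_contDiffOn (hT.mono inter_subset_left)

/-- The smooth open embedding `u ↦ c · u / √(1 + ‖u‖²)` of `ℝⁿ⁺¹` onto the open ball of radius
`c` (Mathlib's `univUnitBall` followed by the homothety `c`), as a global chart. [folklore] -/
def ballChart (c : ℝ) (hc : c ≠ 0) : OpenPartialHomeomorph (𝔼 (n + 1)) (𝔼 (n + 1)) :=
  univUnitBall.trans (scaleChart c hc)

/-- The ball chart is `u ↦ c • univUnitBall u` (definitional). [folklore] -/
theorem ballChart_apply (c : ℝ) (hc : c ≠ 0) (u : 𝔼 (n + 1)) :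
    ballChart c hc u = c • (univUnitBall u : 𝔼 (n + 1)) := rfl

/-- The ball chart is global. [folklore] -/
@[simp] theorem ballChart_source (c : ℝ) (hc : c ≠ 0) :
    (ballChart (n := n) c hc).source = univ := by
  simp [ballChart, univUnitBall_source]

/-- `‖ballChart c u‖ = |c| ‖u‖ / √(1 + ‖u‖²)`. [folklore] -/
theorem norm_ballChart (c : ℝ) (hc : c ≠ 0) (u : 𝔼 (n + 1)) :
    ‖ballChart c hc u‖ = |c| * (‖u‖ / √(1 + ‖u‖ ^ 2)) := by
  rw [ballChart_apply, univUnitBall_apply, norm_smul, norm_smul, norm_inv, Real.norm_eq_abs,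
    Real.norm_eq_abs, abs_of_pos (Real.sqrt_pos.2 (one_add_norm_sq_pos_radialFold u))]
  ring

/-- The ball chart takes values in the open ball of radius `c`. [folklore] -/
theorem norm_ballChart_lt {c : ℝ} (hc : 0 < c) (u : 𝔼 (n + 1)) : ‖ballChart c hc.ne' u‖ < c := by
  rw [ballChart_apply, norm_smul, Real.norm_of_nonneg hc.le]
  have : ‖(univUnitBall u : 𝔼 (n + 1))‖ < 1 := by
    have h := univUnitBall.map_source (mem_univ u : u ∈ (univUnitBall (E := 𝔼 (n + 1))).source)
    rw [univUnitBall_target, mem_ball_zero_iff] at h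
    exact h
  calc c * ‖(univUnitBall u : 𝔼 (n + 1))‖ < c * 1 := mul_lt_mul_of_pos_left this hc
    _ = c := mul_one c

/-- `‖u‖ / √(1 + ‖u‖²) = 1/√2` exactly on the unit sphere. [folklore] -/
theorem norm_div_sqrt_eq_iff (u : 𝔼 (n + 1)) :
    ‖u‖ / √(1 + ‖u‖ ^ 2) = (√2)⁻¹ ↔ ‖u‖ = 1 := by
  have hs : 0 < √(1 + ‖u‖ ^ 2) := Real.sqrt_pos.2 (one_add_norm_sq_pos_radialFold u)
  have h2 : 0 < √(2 : ℝ) := Real.sqrt_pos.2 two_pos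
  constructor
  · intro h
    have h' : ‖u‖ * √2 = √(1 + ‖u‖ ^ 2) := by
      field_simp at h
      linarith
    have h'' := congrArg (fun t : ℝ => t ^ 2) h'
    simp only [mul_pow, Real.sq_sqrt zero_le_two, Real.sq_sqrt (one_add_norm_sq_pos_radialFold u).le] at h''
    have h3 : ‖u‖ ^ 2 = 1 ^ 2 := by linarith
    exact (pow_left_inj₀ (norm_nonneg u) zero_le_one two_ne_zero).1 h3
  · intro h
    rw [h, one_pow, one_add_one_eq_two, one_div]

/-- The ball chart maps the unit sphere into the sphere of radius `c/√2`. [folklore] -/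
theorem norm_ballChart_of_norm_eq_one {c : ℝ} (hc : 0 < c) {u : 𝔼 (n + 1)} (hu : ‖u‖ = 1) :
    ‖ballChart c hc.ne' u‖ = c / √2 := by
  rw [norm_ballChart, (norm_div_sqrt_eq_iff u).2 hu, abs_of_pos hc, div_eq_mul_inv]

/-- Only the unit sphere is mapped by the ball chart to the sphere of radius `c/√2`. [folklore] -/
theorem norm_eq_one_of_norm_ballChart {c : ℝ} (hc : 0 < c) {u : 𝔼 (n + 1)}
    (hu : ‖ballChart c hc.ne' u‖ = c / √2) : ‖u‖ = 1 := by
  rw [norm_ballChart, abs_of_pos hc, div_eq_mul_inv c] at hu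
  exact (norm_div_sqrt_eq_iff u).1 (mul_left_cancel₀ hc.ne' hu)

/-- On the unit sphere the ball chart is the homothety `c/√2`. [folklore] -/
theorem ballChart_of_norm_eq_one {c : ℝ} (hc : c ≠ 0) {u : 𝔼 (n + 1)} (hu : ‖u‖ = 1) :
    ballChart c hc u = (c / √2) • u := by
  rw [ballChart_apply, univUnitBall_apply, hu, one_pow, one_add_one_eq_two, smul_smul,
    div_eq_mul_inv]

/-- The ball chart is differentiable in the manifold sense (both ways). [folklore] -/
theorem mdifferentiable_ballChart (c : ℝ) (hc : c ≠ 0) :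
    (ballChart (n := n) c hc).MDifferentiable (𝓡 (n + 1)) (𝓡 (n + 1)) := by
  refine (mdifferentiable_of_contDiffOn contDiff_univUnitBall.contDiffOn ?_).trans
    (mdifferentiable_of_contDiffOn (contDiff_id.const_smul c).contDiffOn ?_)
  · exact contDiffOn_univUnitBall_symm
  · have h : ((scaleChart (n := n) c hc).symm : 𝔼 (n + 1) → 𝔼 (n + 1)) = fun u => c⁻¹ • u :=
      funext (scaleChart_symm_apply c hc)
    rw [h]
    exact (contDiff_id.const_smul _).contDiffOn

/-- The ball chart is `C^∞`. [folklore] -/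
theorem contMDiff_ballChart (c : ℝ) (hc : c ≠ 0) :
    ContMDiff (𝓡 (n + 1)) (𝓡 (n + 1)) ∞ (ballChart (n := n) c hc) := by
  have h : (ballChart (n := n) c hc : 𝔼 (n + 1) → 𝔼 (n + 1)) =
      fun u => c • (univUnitBall u : 𝔼 (n + 1)) := rfl
  rw [h]
  exact (contDiff_univUnitBall.const_smul c).contMDiff

/-- **Choice of the folding radius.** For a chart `χ` at `q` and a map `g` continuous off `q`
on the compact manifold `M` there is `r > 0` with `‖g‖ < r` off `χ.source` and the coordinate
ball of radius `2/r` inside `χ.target`. [folklore] -/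
theorem exists_poleFoldRadius [CompactSpace M] {q : M} {χ : OpenPartialHomeomorph M (𝔼 (n + 1))}
    (hqχ : q ∈ χ.source)
    (hχq : χ q = 0) {g : M → 𝔼 (n + 1)} (hg : ∀ x, x ≠ q → ContinuousAt g x) :
    ∃ r : ℝ, 1 ≤ r ∧ (∀ x, x ∉ χ.source → ‖g x‖ < r) ∧
      ball (0 : 𝔼 (n + 1)) (2 / r) ⊆ χ.target := by
  have hK : IsCompact (χ.sourceᶜ) := χ.open_source.isClosed_compl.isCompact
  have hcont : ContinuousOn g (χ.sourceᶜ) := fun x hx =>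
    (hg x fun h => hx (h ▸ hqχ)).continuousWithinAt
  obtain ⟨C, hC⟩ := hK.exists_bound_of_continuousOn hcont
  have h0 : (0 : 𝔼 (n + 1)) ∈ χ.target := hχq ▸ χ.map_source hqχ
  obtain ⟨δ, hδ, hδt⟩ := Metric.isOpen_iff.1 χ.open_target 0 h0
  refine ⟨max (C + 1) (max (2 / δ) 1), ?_, fun x hx => ?_, ?_⟩
  · exact (le_max_right _ _).trans (le_max_right _ _)
  · exact (hC x hx).trans_lt ((lt_add_one C).trans_le (le_max_left _ _))
  · refine (ball_subset_ball ?_).trans hδt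
    have hr : 0 < max (C + 1) (max (2 / δ) 1) :=
      one_pos.trans_le ((le_max_right _ _).trans (le_max_right _ _))
    rw [div_le_iff₀ hr]
    calc (2 : ℝ) = δ * (2 / δ) := by field_simp
      _ ≤ δ * max (C + 1) (max (2 / δ) 1) :=
        mul_le_mul_of_nonneg_left ((le_max_left _ _).trans (le_max_right _ _)) hδ.le

/-- **Reduction of the fold map to a pole immersion** (see the section docstring): on a compact
`C^∞` manifold `M` modelled on `ℝⁿ⁺¹`, a chart `χ` of the maximal atlas centred at `q` together
with a map `g : M → ℝⁿ⁺¹`, `C^∞` with injective differential on `M ∖ {q}` and equal to the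
inverted chart `χ / ‖χ‖²` on `χ.source ∖ {q}`, yields a `C^∞` map `f : M → ℝⁿ⁺¹` which is an
immersion off the boundary sphere `e(𝕊ⁿ)` of a coordinate ball `e : ℝⁿ⁺¹ → M` (a `C^∞` open
embedding with injective differential) and has Gromov's fold normal form
`(u₀, u') ↦ (u₀², u')` (PDR §1.3.1 (B) p. 27) along `e(𝕊ⁿ) = {u₀ = 0}` in charts of the maximal
atlases — the shape of `eliashberg_foldMap_homotopySphere_four`.  The map is
`f = r · radialFold (g / r)` (Gromov's Example p. 59 transported by `g`).
[cite: Gromov1986, §1.3.1 (B) p. 27 and §2.1.3 (D) p. 59] -/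
theorem exists_foldMap_of_poleImmersion [T2Space M] [CompactSpace M] [ChartedSpace (𝔼 (n + 1)) M]
    [IsManifold (𝓡 (n + 1)) ∞ M] {q : M} {χ : OpenPartialHomeomorph M (𝔼 (n + 1))}
    (hχ : χ ∈ IsManifold.maximalAtlas (𝓡 (n + 1)) ∞ M) (hqχ : q ∈ χ.source) (hχq : χ q = 0)
    {g : M → 𝔼 (n + 1)} (hg : ∀ x, x ≠ q → ContMDiffAt (𝓡 (n + 1)) (𝓡 (n + 1)) ∞ g x)
    (hg' : ∀ x, x ≠ q → Injective (mfderiv (𝓡 (n + 1)) (𝓡 (n + 1)) g x))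
    (hpole : ∀ x ∈ χ.source, x ≠ q → g x = (‖χ x‖ ^ 2)⁻¹ • χ x) :
    ∃ (e : 𝔼 (n + 1) → M) (f : M → 𝔼 (n + 1)),
      ContMDiff (𝓡 (n + 1)) (𝓡 (n + 1)) ∞ e ∧ Topology.IsEmbedding e ∧
      (∀ y, Injective (mfderiv (𝓡 (n + 1)) (𝓡 (n + 1)) e y)) ∧
      ContMDiff (𝓡 (n + 1)) (𝓡 (n + 1)) ∞ f ∧
      (∀ x, x ∉ range (fun m : 𝕊 n => e m) →
        Injective (mfderiv (𝓡 (n + 1)) (𝓡 (n + 1)) f x)) ∧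
      (∀ m : 𝕊 n, ∃ (φ : OpenPartialHomeomorph M (𝔼 (n + 1)))
          (ψ : OpenPartialHomeomorph (𝔼 (n + 1)) (𝔼 (n + 1))),
          e m ∈ φ.source ∧ φ ∈ IsManifold.maximalAtlas (𝓡 (n + 1)) ∞ M ∧
          ψ ∈ IsManifold.maximalAtlas (𝓡 (n + 1)) ∞ (𝔼 (n + 1)) ∧
          φ.source ⊆ f ⁻¹' ψ.source ∧
          (∀ x ∈ φ.source, ψ (f x) = φ x + ((φ x 0) ^ 2 - φ x 0) •
            EuclideanSpace.single (0 : Fin (n + 1)) (1 : ℝ)) ∧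
          (∀ x ∈ φ.source, x ∈ range (fun m : 𝕊 n => e m) ↔ φ x 0 = 0)) := by
  classical
  /- the radius -/
  obtain ⟨r, hr1, hgr, hrt⟩ := exists_poleFoldRadius hqχ hχq fun x hx => (hg x hx).continuousAt
  have hr : 0 < r := one_pos.trans_le hr1
  have hr0 : r ≠ 0 := hr.ne'
  /- the coordinate ball `e` -/
  set c : ℝ := √2 / r with hc_def
  have h2 : 0 < √(2 : ℝ) := Real.sqrt_pos.2 two_pos
  have hc : 0 < c := div_pos h2 hr
  have hc2 : c / √2 = r⁻¹ := by rw [hc_def]; field_simp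
  have hclt : c < 2 / r := by
    rw [hc_def]
    exact div_lt_div_of_pos_right ((Real.sqrt_lt' two_pos).2 (by norm_num)) hr
  set θ : OpenPartialHomeomorph (𝔼 (n + 1)) (𝔼 (n + 1)) := ballChart c hc.ne' with hθ_def
  have hθt : ∀ u, θ u ∈ χ.target := fun u =>
    hrt (mem_ball_zero_iff.2 ((norm_ballChart_lt hc u).trans hclt))
  set E : OpenPartialHomeomorph (𝔼 (n + 1)) M := θ.trans χ.symm with hE_def
  have hEs : E.source = univ := by
    rw [hE_def, trans_source, hθ_def, ballChart_source, univ_inter]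
    exact eq_univ_of_forall fun u => hθt u
  have hE_apply : ∀ u, E u = χ.symm (θ u) := fun u => rfl
  have hE_md : E.MDifferentiable (𝓡 (n + 1)) (𝓡 (n + 1)) :=
    (mdifferentiable_ballChart c hc.ne').trans (mdifferentiable_of_mem_maximalAtlas_model hχ).symm
  have hE_smooth : ContMDiff (𝓡 (n + 1)) (𝓡 (n + 1)) ∞ E := by
    have : ContMDiffOn (𝓡 (n + 1)) (𝓡 (n + 1)) ∞ E univ := by
      rw [hE_def, coe_trans]
      exact (contMDiffOn_symm_of_mem_maximalAtlas hχ).comp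
        (contMDiff_ballChart c hc.ne').contMDiffOn fun u _ => hθt u
    exact contMDiffOn_univ.1 this
  have hEχ : ∀ u, χ (E u) = θ u := fun u => χ.right_inv (hθt u)
  have hEsrc : ∀ u, E u ∈ χ.source := fun u => χ.map_target (hθt u)
  /- the fold locus `‖r χ‖ = 1` is `e(𝕊ⁿ)` -/
  have hZ : ∀ x ∈ χ.source, (x ∈ range fun m : 𝕊 n => E m) ↔ ‖r • χ x‖ = 1 := by
    intro x hx
    constructor
    · rintro ⟨m, rfl⟩
      rw [hEχ, norm_smul, Real.norm_of_nonneg hr.le, hθ_def,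
        norm_ballChart_of_norm_eq_one hc (norm_eq_of_mem_sphere m), hc2, mul_inv_cancel₀ hr0]
    · intro h1
      rw [norm_smul, Real.norm_of_nonneg hr.le] at h1
      have hv : χ x ∈ θ.target := by
        rw [hθ_def, ballChart, trans_target, scaleChart_target, univ_inter, mem_preimage,
          scaleChart_symm_apply, univUnitBall_target, mem_ball_zero_iff, norm_smul, norm_inv,
          Real.norm_of_nonneg hc.le]
        have : c⁻¹ * ‖χ x‖ = (√2)⁻¹ := by
          rw [hc_def]
          field_simp
          linarith
        rw [this, inv_lt_one_iff₀]
        exact Or.inr ((Real.lt_sqrt zero_le_one).2 (by norm_num))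
      refine ⟨⟨θ.symm (χ x), ?_⟩, ?_⟩
      · rw [mem_sphere_zero_iff_norm]
        refine norm_eq_one_of_norm_ballChart hc ?_
        rw [← hθ_def, θ.right_inv hv, hc2]
        field_simp
        linarith
      · change χ.symm (θ (θ.symm (χ x))) = x
        rw [θ.right_inv hv, χ.left_inv hx]
  /- the map `f` -/
  obtain ⟨f, hfq, hf⟩ : ∃ f : M → 𝔼 (n + 1), f q = 0 ∧
      ∀ x, x ≠ q → f x = r • radialFold n (r⁻¹ • g x) :=
    ⟨fun x => if x = q then 0 else r • radialFold n (r⁻¹ • g x), if_pos rfl,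
      fun x hx => if_neg hx⟩
  have hfχ : EqOn f (fun x => r • radialFold n (r • χ x)) χ.source := by
    intro x hx
    by_cases hxq : x = q
    · subst hxq
      simp [hfq, hχq]
    · have hx0 : χ x ≠ 0 := by
        intro h0
        exact hxq (χ.injOn hx hqχ (h0.trans hχq.symm))
      simp only [hf x hxq, hpole x hx hxq]
      rw [radialFold_inv_smul_inversion hr hx0]
  have hfχ' : ∀ x ∈ χ.source, f =ᶠ[𝓝 x] ((fun u => r • radialFold n (r • u)) ∘ χ) := fun x hx =>
    Filter.eventuallyEq_of_mem (χ.open_source.mem_nhds hx) hfχ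
  have hfg' : ∀ x, x ≠ q → f =ᶠ[𝓝 x] ((fun v => r • radialFold n (r⁻¹ • v)) ∘ g) := fun x hx =>
    Filter.eventuallyEq_of_mem (isOpen_compl_singleton.mem_nhds hx) fun y hy => hf y hy
  have hF₁ : ContDiff ℝ ∞ fun u : 𝔼 (n + 1) => r • radialFold n (r • u) :=
    contDiff_smul_radialFold_smul r r
  have hF₂ : ContDiff ℝ ∞ fun v : 𝔼 (n + 1) => r • radialFold n (r⁻¹ • v) :=
    contDiff_smul_radialFold_smul r r⁻¹
  have hf_smooth : ContMDiff (𝓡 (n + 1)) (𝓡 (n + 1)) ∞ f := by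
    intro x
    by_cases hx : x ∈ χ.source
    · exact (hF₁.contMDiff.contMDiffAt.comp x (contMDiffAt_of_mem_maximalAtlas hχ hx)
        ).congr_of_eventuallyEq (hfχ' x hx)
    · have hxq : x ≠ q := fun h => hx (h ▸ hqχ)
      exact (hF₂.contMDiff.contMDiffAt.comp x (hg x hxq)).congr_of_eventuallyEq (hfg' x hxq)
  /- the differential of `f` off the fold locus -/
  have hdf₁ : ∀ x ∈ χ.source, ‖r • χ x‖ ≠ 1 →
      Injective (mfderiv (𝓡 (n + 1)) (𝓡 (n + 1)) f x) := by
    intro x hx h1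
    rw [(hfχ' x hx).mfderiv_eq, mfderiv_comp x (hF₁.contMDiff.contMDiffAt.mdifferentiableAt
      (by simp)) ((contMDiffAt_of_mem_maximalAtlas hχ hx).mdifferentiableAt (by simp)),
      mfderiv_eq_fderiv]
    exact (injective_fderiv_smul_radialFold_smul hr0 hr0 h1).comp
      ((mdifferentiable_of_mem_maximalAtlas_model hχ).mfderiv_injective hx)
  have hdf₂ : ∀ x, x ∉ χ.source → Injective (mfderiv (𝓡 (n + 1)) (𝓡 (n + 1)) f x) := by
    intro x hx
    have hxq : x ≠ q := fun h => hx (h ▸ hqχ)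
    have h1 : ‖r⁻¹ • g x‖ ≠ 1 := by
      rw [norm_smul, norm_inv, Real.norm_of_nonneg hr.le]
      have : r⁻¹ * ‖g x‖ < 1 := by
        rw [inv_mul_lt_iff₀ hr, mul_one]
        exact hgr x hx
      exact this.ne
    rw [(hfg' x hxq).mfderiv_eq, mfderiv_comp x (hF₂.contMDiff.contMDiffAt.mdifferentiableAt
      (by simp)) ((hg x hxq).mdifferentiableAt (by simp)), mfderiv_eq_fderiv]
    exact (injective_fderiv_smul_radialFold_smul hr0 (inv_ne_zero hr0) h1).comp (hg' x hxq)
  /- assembling -/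
  refine ⟨E, f, hE_smooth, (E.to_isOpenEmbedding hEs).isEmbedding,
    fun y => hE_md.mfderiv_injective (by rw [hEs]; exact mem_univ y), hf_smooth, ?_, ?_⟩
  · intro x hxZ
    by_cases hx : x ∈ χ.source
    · exact hdf₁ x hx fun h => hxZ ((hZ x hx).2 h)
    · exact hdf₂ x hx
  · intro m
    -- the charts of the normal form at `e m`
    let D : OpenPartialHomeomorph (𝔼 (n + 1)) (𝔼 (n + 1)) :=
      (scaleChart r hr0).trans (foldSourceChart m)
    let φ : OpenPartialHomeomorph M (𝔼 (n + 1)) := χ.trans D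
    let ψ : OpenPartialHomeomorph (𝔼 (n + 1)) (𝔼 (n + 1)) :=
      (scaleChart r⁻¹ (inv_ne_zero hr0)).trans (foldTargetChart m)
    have hφs : ∀ x, x ∈ φ.source ↔ x ∈ χ.source ∧ r • χ x ∈ (polarChart m).source := by
      intro x
      simp [φ, D]
    have hφ_apply : ∀ x, φ x = foldSourceChart m (r • χ x) := fun x => rfl
    have hψs : ∀ v, v ∈ ψ.source ↔ r⁻¹ • v ∈ (polarChart m).source := by
      intro v
      simp [ψ]
    have hψ_apply : ∀ v, ψ v = foldTargetChart m (r⁻¹ • v) := fun v => rfl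
    refine ⟨φ, ψ, ?_, ?_, ?_, ?_, ?_, ?_⟩
    · -- `e m ∈ φ.source`
      rw [hφs]
      refine ⟨hEsrc m, ?_⟩
      rw [hEχ, hθ_def, ballChart_of_norm_eq_one hc.ne' (norm_eq_of_mem_sphere m), smul_smul,
        hc2, mul_inv_cancel₀ hr0, one_smul, ← foldSourceChart_source]
      rw [foldSourceChart_source]
      exact mem_polarChart_source_self m
    · -- `φ` is a chart of the maximal atlas of `M`
      exact trans_mem_maximalAtlas_of_contDiffOn hχ D
        (contDiffOn_scaleChart_trans hr0 (contDiffOn_foldSourceChart m))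
        (contDiffOn_scaleChart_trans_symm hr0 (contDiffOn_foldSourceChart_symm m))
    · -- `ψ` is a chart of the maximal atlas of `ℝⁿ⁺¹`
      exact mem_maximalAtlas_euclidean_of_contDiffOn
        (contDiffOn_scaleChart_trans _ (contDiffOn_foldTargetChart m))
        (contDiffOn_scaleChart_trans_symm _ (contDiffOn_foldTargetChart_symm m))
    · -- `φ.source ⊆ f ⁻¹' ψ.source`
      intro x hx
      obtain ⟨hxχ, hw⟩ := (hφs x).1 hx
      rw [mem_preimage, hψs, hfχ hxχ, smul_smul, inv_mul_cancel₀ hr0, one_smul]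
      exact radialFold_mem_polarChart_source hw
    · -- the normal form
      intro x hx
      obtain ⟨hxχ, hw⟩ := (hφs x).1 hx
      rw [hψ_apply, hφ_apply, hfχ hxχ, smul_smul, inv_mul_cancel₀ hr0, one_smul]
      exact foldTargetChart_radialFold hw
    · -- the fold locus is `{φ₀ = 0}`
      intro x hx
      obtain ⟨hxχ, hw⟩ := (hφs x).1 hx
      rw [hφ_apply, foldSourceChart_apply_zero_eq_zero_iff]
      exact hZ x hxχ

end Reduction

/-! ### §4 The named fact over pole immersions of punctured homotopy 4-spheres -/

/-- **`eliashberg_foldMap_homotopySphere_four` reduced to pole immersions.**  The named fact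
(Gromov, PDR §2.1.3 (D) Theorem p. 59, instance) follows from: *every smooth homotopy 4-sphere
`M` carries a chart `χ` of its maximal atlas centred at some `q` and a `C^∞` immersion
`g : M ∖ {q} → ℝ⁴` which equals the inverted chart `χ / ‖χ‖²` near `q`* — an immersion of the
(contractible, parallelisable) punctured homotopy sphere with a standard pole at the puncture,
which is what Eliashberg's `h`-principle applied to the trivial folded tangent bundle provides
(and conversely what any fold map along a coordinate sphere yields after composing with the
inverse of the radial fold on one sheet).  Compactness of `M` is the tree's
`compactSpace_of_homotopyEquiv_sphere_four_holds`; the rest is `exists_foldMap_of_poleImmersion`.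
The hypothesis is carried explicitly; it is NOT a declaration of the tree.
[cite: Gromov1986, §2.1.3 (D) Theorem p. 59 and §1.3.1 (B) p. 27] -/
theorem eliashberg_foldMap_homotopySphere_four_of_poleImmersion
    (H : ∀ (M : Type) [TopologicalSpace M] [T2Space M] [SecondCountableTopology M]
      [ChartedSpace (EuclideanSpace ℝ (Fin 4)) M] [IsManifold (𝓡 4) ∞ M],
      M ≃ₕ Metric.sphere (0 : EuclideanSpace ℝ (Fin 5)) 1 →
      ∃ (q : M) (χ : OpenPartialHomeomorph M (EuclideanSpace ℝ (Fin 4)))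
        (g : M → EuclideanSpace ℝ (Fin 4)),
        χ ∈ IsManifold.maximalAtlas (𝓡 4) ∞ M ∧ q ∈ χ.source ∧ χ q = 0 ∧
        (∀ x, x ≠ q → ContMDiffAt (𝓡 4) (𝓡 4) ∞ g x) ∧
        (∀ x, x ≠ q → Injective (mfderiv (𝓡 4) (𝓡 4) g x)) ∧
        (∀ x ∈ χ.source, x ≠ q → g x = (‖χ x‖ ^ 2)⁻¹ • χ x)) :
    eliashberg_foldMap_homotopySphere_four := by
  intro M _ _ _ _ _ hM
  haveI : CompactSpace M := compactSpace_of_homotopyEquiv_sphere_four_holds M hM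
  obtain ⟨q, χ, g, hχ, hqχ, hχq, hg, hg', hpole⟩ := H M hM
  exact exists_foldMap_of_poleImmersion (n := 3) hχ hqχ hχq hg hg' hpole

end Literature.Topology.FourManifolds
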